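import Mathlib

/-!
# Carathéodory's inequality for Taylor coefficients (the coefficient form of Borel–Carathéodory)

For `f` holomorphic on the disc `‖z‖ < R` and continuous on its closure, with `Re f ≤ B` on the circle `‖z‖ = R`,
the Cauchy coefficients satisfy `‖a_n‖ ≤ 2(B − Re f(0))/Rⁿ` for every `n ≥ 1` (sharper, at the level of coefficients,
than the Borel–Carathéodory sup-norm bound `Complex.borelCaratheodory` of Mathlib).  Proof: with `z = Re^{iθ}`,
`a_n Rⁿ = (2π)⁻¹ ∫₀^{2π} e^{−inθ} f dθ`, Cauchy's theorem kills `∫ e^{inθ} f dθ` (`n ≥ 1`), hence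
`a_n Rⁿ = π⁻¹ ∫ e^{−inθ} Re f dθ = −π⁻¹ ∫ e^{−inθ}(B − Re f) dθ` and `|a_n| Rⁿ ≤ π⁻¹∫ (B − Re f) = 2(B − Re f(0))`
by the mean-value property.  Topic `Literature/Analysis/Complex` (used by the Jensen programme's window-EGF
cumulant bounds, cell rh-jensen, route `JensenPolynomials`, support G1 `WindowCumulantOfZeroFree`).

References: E. C. Titchmarsh, *The Theory of Functions*, 2nd ed. (1939), §5.5 (Borel–Carathéodory) and the
coefficient inequality of Carathéodory proved there. [Titchmarsh1939]
-/

noncomputable section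

open Complex MeasureTheory Set Metric intervalIntegral
open scoped Real

namespace Literature.Analysis.Complex

/-- Parametrisation of the Cauchy-coefficient integral: `∮_{|z|=R} z^{−(n+1)} f(z) dz = i R^{−n} ∫₀^{2π} e^{−inθ} f(Re^{iθ}) dθ`.
[cite: Titchmarsh1939, §2.5] -/
theorem circleIntegral_inv_pow_smul_eq {R : ℝ} (hR : 0 < R) (n : ℕ) (f : ℂ → ℂ) :
    (∮ z in C(0, R), z⁻¹ ^ n • z⁻¹ • f z) =
      (I * ((R : ℂ)⁻¹) ^ n) * ∫ θ in (0 : ℝ)..2 * π, exp (-((n : ℂ) * θ * I)) * f (circleMap 0 R θ) := by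
  rw [circleIntegral, ← intervalIntegral.integral_const_mul]
  refine intervalIntegral.integral_congr fun θ _ => ?_
  simp only [deriv_circleMap, circleMap_zero, smul_eq_mul]
  have hR' : (R : ℂ) ≠ 0 := by exact_mod_cast hR.ne'
  have hE : exp ((θ : ℂ) * I) ≠ 0 := exp_ne_zero _
  have hexp : exp (-((n : ℂ) * θ * I)) = (exp ((θ : ℂ) * I))⁻¹ ^ n := by
    rw [← Complex.exp_neg, ← Complex.exp_nat_mul]; congr 1; ring
  rw [hexp, mul_inv, mul_pow]
  field_simp

/-- Parametrisation of `∮_{|z|=R} zⁿ f(z) dz = i R^{n+1} ∫₀^{2π} e^{i(n+1)θ} f(Re^{iθ}) dθ`. [cite: Titchmarsh1939, §2.5] -/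
theorem circleIntegral_pow_smul_eq {R : ℝ} (n : ℕ) (f : ℂ → ℂ) :
    (∮ z in C(0, R), z ^ n • f z) =
      (I * (R : ℂ) ^ (n + 1)) * ∫ θ in (0 : ℝ)..2 * π, exp (((n : ℂ) + 1) * θ * I) * f (circleMap 0 R θ) := by
  rw [circleIntegral, ← intervalIntegral.integral_const_mul]
  refine intervalIntegral.integral_congr fun θ _ => ?_
  simp only [deriv_circleMap, circleMap_zero, smul_eq_mul]
  rw [mul_pow, ← Complex.exp_nat_mul, show (((n : ℂ) + 1) * θ * I) = (n : ℂ) * (θ * I) + θ * I by ring,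
    Complex.exp_add]
  ring

/-- Cauchy's theorem on the circle in Fourier form: `∫₀^{2π} e^{ikθ} f(Re^{iθ}) dθ = 0` for `k ≥ 1` when `f` is
holomorphic in the disc and continuous up to the boundary. [cite: Titchmarsh1939, §2.4] -/
theorem integral_exp_mul_circleMap_eq_zero {R : ℝ} (hR : 0 < R) {f : ℂ → ℂ} (hf : DiffContOnCl ℂ f (ball 0 R))
    {k : ℕ} (hk : 1 ≤ k) :
    ∫ θ in (0 : ℝ)..2 * π, exp ((k : ℂ) * θ * I) * f (circleMap 0 R θ) = 0 := by
  obtain ⟨n, rfl⟩ : ∃ n, k = n + 1 := ⟨k - 1, by omega⟩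
  have hcont : ContinuousOn f (closedBall 0 R) := by
    have := hf.continuousOn; rwa [closure_ball 0 hR.ne'] at this
  have hzero : (∮ z in C(0, R), z ^ n • f z) = 0 := by
    refine Complex.circleIntegral_eq_zero_of_differentiable_on_off_countable hR.le (s := ∅)
      Set.countable_empty ?_ ?_
    · exact (continuousOn_id.pow n).smul hcont
    · intro z hz
      exact ((differentiableAt_id.pow n).smul (hf.differentiableAt isOpen_ball hz.1))
  rw [circleIntegral_pow_smul_eq n f] at hzero
  have hc : (I * (R : ℂ) ^ (n + 1)) ≠ 0 := by
    have hR' : (R : ℂ) ≠ 0 := by exact_mod_cast hR.ne'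
    exact mul_ne_zero I_ne_zero (pow_ne_zero _ hR')
  have := (mul_eq_zero.mp hzero).resolve_left hc
  push_cast
  exact this

/-- The mean-value property in Fourier form: `∫₀^{2π} f(Re^{iθ}) dθ = 2π·f(0)`. [cite: Titchmarsh1939, §2.4] -/
theorem integral_circleMap_eq_two_pi_mul {R : ℝ} (hR : 0 < R) {f : ℂ → ℂ} (hf : DiffContOnCl ℂ f (ball 0 R)) :
    ∫ θ in (0 : ℝ)..2 * π, f (circleMap 0 R θ) = 2 * π * f 0 := by
  have h := hf.circleIntegral_sub_inv_smul (mem_ball_self hR)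
  have h0 : (∮ z in C(0, R), (z - 0)⁻¹ • f z) = ∮ z in C(0, R), z⁻¹ ^ 0 • z⁻¹ • f z := by
    simp only [sub_zero, pow_zero, one_smul]
  rw [h0, circleIntegral_inv_pow_smul_eq hR 0 f] at h
  simp only [pow_zero, mul_one, Nat.cast_zero, zero_mul, neg_zero, Complex.exp_zero, one_mul,
    smul_eq_mul] at h
  have hI : I ≠ 0 := I_ne_zero
  have h' : I * (∫ θ in (0 : ℝ)..2 * π, f (circleMap 0 R θ)) = I * (2 * π * f 0) := by
    rw [h]; ring
  exact mul_left_cancel₀ hI h'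

/-- `∫₀^{2π} e^{−inθ} dθ = 0` for `n ≥ 1`. [folklore] -/
private theorem integral_exp_neg_nat_mul_eq_zero {n : ℕ} (hn : 1 ≤ n) :
    ∫ θ in (0 : ℝ)..2 * π, exp (-((n : ℂ) * θ * I)) = 0 := by
  have hc : (-((n : ℂ) * I)) ≠ 0 := by
    have hn' : (n : ℂ) ≠ 0 := by exact_mod_cast (show n ≠ 0 by omega)
    exact neg_ne_zero.2 (mul_ne_zero hn' I_ne_zero)
  have h := integral_exp_mul_complex (a := 0) (b := 2 * π) hc
  have e : (fun θ : ℝ => exp (-((n : ℂ) * θ * I))) = fun θ : ℝ => exp (-((n : ℂ) * I) * θ) := by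
    funext θ; congr 1; ring
  rw [e, h]
  have h1 : exp (-((n : ℂ) * I) * ((2 * π : ℝ) : ℂ)) = 1 := by
    rw [show -((n : ℂ) * I) * ((2 * π : ℝ) : ℂ) = ((-(n : ℤ) : ℤ) : ℂ) * (2 * π * I) by push_cast; ring]
    exact Complex.exp_int_mul_two_pi_mul_I (-(n : ℤ))
  rw [h1]
  simp

/-- **Carathéodory's inequality for the Taylor coefficients (coefficient form of Borel–Carathéodory).** If `f` is
holomorphic on `‖z‖ < R`, continuous on `‖z‖ ≤ R`, and `Re f ≤ B` on the circle `‖z‖ = R`, then the `n`-th Cauchy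
coefficient `a_n = (2πi)⁻¹∮_{|z|=R} f(z) z^{−n−1} dz` satisfies `‖a_n‖ ≤ 2(B − Re f(0))/Rⁿ` for every `n ≥ 1`.
[cite: Titchmarsh1939, §5.5] -/
theorem norm_cauchyCoeff_le_of_re_le {R : ℝ} (hR : 0 < R) {f : ℂ → ℂ} (hf : DiffContOnCl ℂ f (ball 0 R))
    {B : ℝ} (hB : ∀ θ : ℝ, (f (circleMap 0 R θ)).re ≤ B) {n : ℕ} (hn : 1 ≤ n) :
    ‖(2 * π * I : ℂ)⁻¹ • ∮ z in C(0, R), z⁻¹ ^ n • z⁻¹ • f z‖ ≤ 2 * (B - (f 0).re) / R ^ n := by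
  set g : ℝ → ℂ := fun θ => f (circleMap 0 R θ) with hg
  have hcont : ContinuousOn f (closedBall 0 R) := by
    have := hf.continuousOn; rwa [closure_ball 0 hR.ne'] at this
  have hgc : Continuous g :=
    hcont.comp_continuous (continuous_circleMap 0 R) (fun θ => circleMap_mem_closedBall 0 hR.le θ)
  have hec : Continuous fun θ : ℝ => exp (-((n : ℂ) * θ * I)) := by fun_prop
  -- Fourier facts
  have hvan : ∫ θ in (0 : ℝ)..2 * π, exp ((n : ℂ) * θ * I) * g θ = 0 :=
    integral_exp_mul_circleMap_eq_zero hR hf hn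
  have hmean : ∫ θ in (0 : ℝ)..2 * π, g θ = 2 * π * f 0 := integral_circleMap_eq_two_pi_mul hR hf
  -- the conjugate of the vanishing integral
  have hconj : ∫ θ in (0 : ℝ)..2 * π, exp (-((n : ℂ) * θ * I)) * (starRingEnd ℂ) (g θ) = 0 := by
    have h1 : (fun θ : ℝ => exp (-((n : ℂ) * θ * I)) * (starRingEnd ℂ) (g θ)) =
        fun θ : ℝ => (starRingEnd ℂ) (exp ((n : ℂ) * θ * I) * g θ) := by
      funext θ
      rw [map_mul, ← Complex.exp_conj, map_mul, map_mul, Complex.conj_ofReal, Complex.conj_I,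
        map_natCast]
      ring_nf
    rw [h1, intervalIntegral.integral_of_le Real.two_pi_pos.le, integral_conj,
      ← intervalIntegral.integral_of_le Real.two_pi_pos.le, hvan, map_zero]
  -- the coefficient integral in terms of `B − Re g`
  have hgi : IntervalIntegrable (fun θ => exp (-((n : ℂ) * θ * I)) * g θ) volume 0 (2 * π) :=
    (hec.mul hgc).intervalIntegrable _ _
  have hci : IntervalIntegrable (fun θ => exp (-((n : ℂ) * θ * I)) * (starRingEnd ℂ) (g θ)) volume 0 (2 * π) :=
    (hec.mul (Complex.continuous_conj.comp hgc)).intervalIntegrable _ _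
  have hdi : IntervalIntegrable (fun θ => exp (-((n : ℂ) * θ * I)) *
      (2 * (((B - (g θ).re : ℝ)) : ℂ))) volume 0 (2 * π) := by
    refine (hec.mul ?_).intervalIntegrable _ _
    exact continuous_const.mul (Complex.continuous_ofReal.comp
      (continuous_const.sub (Complex.continuous_re.comp hgc)))
  have hkey : ∫ θ in (0 : ℝ)..2 * π, exp (-((n : ℂ) * θ * I)) * g θ =
      -∫ θ in (0 : ℝ)..2 * π, exp (-((n : ℂ) * θ * I)) * (2 * (((B - (g θ).re : ℝ)) : ℂ)) := by
    have e : ∀ θ : ℝ, exp (-((n : ℂ) * θ * I)) * g θ =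
        (2 * B) * exp (-((n : ℂ) * θ * I)) - exp (-((n : ℂ) * θ * I)) * (starRingEnd ℂ) (g θ)
          - exp (-((n : ℂ) * θ * I)) * (2 * (((B - (g θ).re : ℝ)) : ℂ)) := by
      intro θ
      have hre : (2 * ((g θ).re : ℂ)) = g θ + (starRingEnd ℂ) (g θ) := by
        rw [Complex.add_conj]; push_cast; ring
      push_cast
      linear_combination (-exp (-((n : ℂ) * θ * I))) * hre
    rw [intervalIntegral.integral_congr (fun θ _ => e θ), intervalIntegral.integral_sub,
      intervalIntegral.integral_sub, intervalIntegral.integral_const_mul, hconj,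
      integral_exp_neg_nat_mul_eq_zero hn]
    · ring
    · exact (continuous_const.mul hec).intervalIntegrable _ _
    · exact hci
    · exact ((continuous_const.mul hec).intervalIntegrable _ _).sub hci
    · exact hdi
  -- norm bound of the last integral
  have hnorm : ‖∫ θ in (0 : ℝ)..2 * π, exp (-((n : ℂ) * θ * I)) * (2 * (((B - (g θ).re : ℝ)) : ℂ))‖ ≤
      ∫ θ in (0 : ℝ)..2 * π, 2 * (B - (g θ).re) := by
    refine (intervalIntegral.norm_integral_le_integral_norm Real.two_pi_pos.le).trans_eq ?_
    refine intervalIntegral.integral_congr fun θ _ => ?_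
    have h2 : 0 ≤ 2 * (B - (g θ).re) := by linarith [hB θ]
    rw [norm_mul, show (-((n : ℂ) * θ * I)) = ((-((n : ℝ) * θ) : ℝ) : ℂ) * I by push_cast; ring,
      Complex.norm_exp_ofReal_mul_I, one_mul]
    rw [show (2 * (((B - (g θ).re : ℝ)) : ℂ)) = (((2 * (B - (g θ).re) : ℝ)) : ℂ) by push_cast; ring,
      Complex.norm_real, Real.norm_of_nonneg h2]
  have hval : ∫ θ in (0 : ℝ)..2 * π, 2 * (B - (g θ).re) = 2 * (2 * π * B - 2 * π * (f 0).re) := by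
    have hre : ∫ θ in (0 : ℝ)..2 * π, (g θ).re = 2 * π * (f 0).re := by
      have h1 := intervalIntegral.integral_of_le (μ := volume) (f := fun θ => (g θ).re) Real.two_pi_pos.le
      rw [h1, show (fun θ => (g θ).re) = fun θ => RCLike.re (g θ) from rfl, integral_re
        ((hgc.integrableOn_Icc).mono_set Set.Ioc_subset_Icc_self),
        ← intervalIntegral.integral_of_le Real.two_pi_pos.le, hmean]
      simp
    have hri : IntervalIntegrable (fun θ => (g θ).re) volume 0 (2 * π) :=
      (Complex.continuous_re.comp hgc).intervalIntegrable _ _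
    rw [intervalIntegral.integral_const_mul, intervalIntegral.integral_sub intervalIntegrable_const hri,
      intervalIntegral.integral_const, hre]
    simp
  -- assemble
  have hfinal : ‖∫ θ in (0 : ℝ)..2 * π, exp (-((n : ℂ) * θ * I)) * (2 * (((B - (g θ).re : ℝ)) : ℂ))‖ ≤
      2 * (2 * π * B - 2 * π * (f 0).re) := hnorm.trans_eq hval
  rw [circleIntegral_inv_pow_smul_eq hR n f, hkey]
  simp only [norm_smul, norm_mul, norm_inv, norm_neg, norm_pow, Complex.norm_I, Complex.norm_real,
    Complex.norm_ofNat, Real.norm_eq_abs, abs_of_pos Real.pi_pos, abs_of_pos hR, mul_one, one_mul]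
  calc (2 * π)⁻¹ * (R⁻¹ ^ n *
        ‖∫ θ in (0 : ℝ)..2 * π, exp (-((n : ℂ) * θ * I)) * (2 * (((B - (g θ).re : ℝ)) : ℂ))‖)
      ≤ (2 * π)⁻¹ * (R⁻¹ ^ n * (2 * (2 * π * B - 2 * π * (f 0).re))) := by gcongr
    _ = 2 * (B - (f 0).re) / R ^ n := by
        rw [inv_pow]; field_simp

end Literature.Analysis.Complex

end
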